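import Literature.NumberTheory.GaloisRepresentations.DeformationProfiniteLevel
import Literature.NumberTheory.GaloisRepresentations.DeformationCofinalSubgroups
import Literature.NumberTheory.GaloisRepresentations.NearlyOrdinaryRigidCondition
import Literature.NumberTheory.EllipticCurves.H1UnramifiedFiniteProofs
import HarnessLib

/-!
# Existence of the universal nearly ordinary deformation ring (Calegari–Mazur §2.2):
# discharge of `nearlyOrdinaryDeformationRing_nonempty`

`Proofs` companion of `NearlyOrdinaryDeformationRing`.  Calegari–Mazur, *Nearly ordinary Galois
deformations over arbitrary number fields*, §2.2 (p. 9 of arXiv:0708.2451): *"suppose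
that `ρ̄` satisfies `End_𝔽(ρ̄) = 𝔽` and is nearly ordinary and distinguished at each `v ∣ p`; then
`ρ̄` admits a universal nearly ordinary deformation ring `R(ρ̄)`.  The proof of this is standard,
see [Mazur, §30]."*  Mazur §30 in turn says: near-ordinarity (with the `p`-distinguishedness
making the special line unique) is a *deformation condition* (§23), hence relatively
representable (§23 Lemma, §19–§20), and absolutely representable when `ρ̄` satisfies the
representability hypothesis `End = k` (§20 Prop. 2, via Schlessinger §18 and the `p`-finiteness
`Φ_p` of `Π = G_{F,S}`, §21).  This file completes that argument on top of the library's explicit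
form of Mazur's machine:

* `DeformationCoefficientAlgebras`, `DeformationFiniteLevel`, `DeformationProfiniteLevel`:
  the category `Ĉ_𝒪(k)`, lifting conditions `𝒞` (Mazur §23, including the gluing axiom), the
  finite-level universal rings `R_U` and **§20 Prop. 2** in the form
  `LiftingCondition.exists_universal_of_finite`: a lifting condition with finitely many
  `k[ε]`-points is representable on `Ĉ_𝒪(k)` (the universal ring is built as the sequential
  limit `lim_N R_{U_N}` along a cofinal sequence of open normal subgroups — supplied for `Γ_F` by
  `DeformationCofinalSubgroups` — instead of quoting Schlessinger).
* `NearlyOrdinaryDeformationHensel`: Hensel eigenframes over Henselian coefficient rings, making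
  the special line at a `p`-distinguished place unique and functorial.
* `NearlyOrdinaryRigidCondition`: Skinner–Wiles **rigidification** data `R : 𝒟.RigidData` and the
  rigid nearly ordinary lifting condition `R.liftingCondition` of lifts of `r̄' = Ē⁻¹ ρ̄ Ē`.

Contents of this file:

1. `NearlyOrdinaryDatum.nonempty_rigidData`: rigidification data exist under CM's hypotheses
   (a `p`-distinguished place gives `g₀` with `ρ̄(g₀)` diagonalizable with distinct eigenvalues
   over `k` — `p` splits no rôle — and `End_k(ρ̄) = k` gives a non-zero off-diagonal entry).
2. `RigidData.noAt_iff_exists_frame`: the closed (polynomial) near-ordinarity condition `NOAt`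
   of the rigid condition is equivalent, over Henselian `A`, to the frame condition of
   `NearlyOrdinaryDatum.IsNearlyOrdinaryAt`.
3. **Rigidification** (`RigidData.exists_rigid`, `RigidData.rigid_unique`): over a Henselian local
   `A`, every strict equivalence class of continuous lifts of `r̄'` (unramified outside `S`, nearly
   ordinary above `p`) contains exactly one *rigid* lift (`ρ(g₀)` diagonal, `ρ(τ)_{i₀j₀} = t`):
   existence by diagonalising `ρ(g₀)` in its Hensel eigenframe and rescaling by a diagonal matrix
   `≡ 1`; uniqueness because a matrix `≡ 1` commuting with the diagonal `ρ(g₀)` is diagonal, and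
   then scalar by the normalisation at `τ`, using `End_k(ρ̄) = k` only through the data.
4. `RigidData.nonempty_deformationRing`: from `exists_universal_of_finite` for `R.liftingCondition`
   (given finiteness of its `k[ε]`-points) to a `NearlyOrdinaryDeformationRing 𝒟`: the universal
   ring is Mazur's, `ρ_𝒟 = E ρ_univ E⁻¹`, the universal frames come from (2), and the universal
   property among *deformations* (lifts up to strict equivalence) is (3).
5. `RigidData.finite_carrier_dualCNL` (**`Φ_p`-input**): the rigid lifts of `r̄'` to `k[ε]` are
   finite in number — a lift is `(1 + ε c) r̄'` and is determined by its values on coset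
   representatives of the open subgroup `ker r̄'` together with the continuous homomorphism
   `c|_{ker r̄'} : ker r̄' → M₂(k)`, which is unramified outside `S`, and such homomorphisms are
   finite in number by Silverman's Prop. VIII.1.6 / Hermite–Minkowski
   (`Literature.NumberTheory.EllipticCurves.finite_unramifiedHoms_holds`).
6. `nearlyOrdinaryDeformationRing_nonempty_holds`.

References: F. Calegari, B. Mazur, *Nearly ordinary Galois deformations over arbitrary number
fields*, J. Inst. Math. Jussieu 8 (2009) 99–177, §2.1–2.2; B. Mazur, *An introduction to the
deformation theory of Galois representations*, in *Modular Forms and Fermat's Last Theorem*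
(Cornell–Silverman–Stevens, eds.), Springer 1997, §18–§23, §30; C. Skinner, A. Wiles, *Residually
reducible representations and modular forms*, Publ. Math. IHÉS 89 (1999), §2.1; J. Silverman,
*The Arithmetic of Elliptic Curves*, 2nd ed., Prop. VIII.1.6.
-/

noncomputable section

open IsLocalRing Matrix IsDedekindDomain Field
open scoped NumberField

namespace Literature.NumberTheory.GaloisRepresentations

namespace NearlyOrdinaryDatum

open Deformation

variable {F : Type} [Field F] [NumberField F] {p : ℕ} {𝒪 : Type} [CommRing 𝒪] {k : Type}
  [Field k] [Algebra 𝒪 k] (𝒟 : NearlyOrdinaryDatum F p 𝒪 k)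

/-! ### Existence of rigidification data -/

/-- A number field has a prime above `p`. [folklore] -/
theorem exists_heightOneSpectrum_mem (hp : p.Prime) :
    ∃ v : HeightOneSpectrum (𝓞 F), (p : 𝓞 F) ∈ v.asIdeal := by
  haveI : (Ideal.span {(p : ℤ)}).IsMaximal :=
    Ideal.IsPrime.isMaximal (Ideal.span_singleton_prime (by exact_mod_cast hp.ne_zero) |>.2
      (Nat.prime_iff_prime_int.1 hp)) (by
        rw [Ne, Ideal.span_singleton_eq_bot]; exact_mod_cast hp.ne_zero)
  obtain ⟨Q, hQmax, hQ⟩ := Ideal.exists_ideal_over_maximal_of_isIntegral (S := 𝓞 F)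
    (Ideal.span {(p : ℤ)}) (by
      rw [(RingHom.injective_iff_ker_eq_bot _).1 (algebraMap ℤ (𝓞 F)).injective_int]; exact bot_le)
  have hpQ : (p : 𝓞 F) ∈ Q := by
    have : (p : ℤ) ∈ Q.comap (algebraMap ℤ (𝓞 F)) := hQ ▸ Ideal.mem_span_singleton_self _
    simpa using this
  refine ⟨⟨Q, hQmax.isPrime, fun h => ?_⟩, hpQ⟩
  rw [h] at hpQ
  have : (p : 𝓞 F) = 0 := hpQ
  exact hp.ne_zero (by exact_mod_cast this)

/-- Over the residue field, a residually distinguished upper-triangular matrix has the eigenvalue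
`M₁₁` as a root of its characteristic polynomial. [folklore] -/
theorem isCharRoot_of_lowerLeft_eq_zero {K : Type*} [CommRing K] {M : Matrix (Fin 2) (Fin 2) K}
    (h : M 1 0 = 0) : IsCharRoot M (M 1 1) := by
  unfold IsCharRoot; rw [h]; ring

variable [IsLocalRing 𝒪]

/-- **Rigidification data exist** when `ρ̄` has scalar centralizer and is distinguished at some
place above `p` (and `p` is prime, so that there is such a place). [cite: SkinnerWiles1999, §2.1] -/
theorem nonempty_rigidData (hp : p.Prime) (hsc : 𝒟.HasScalarCentralizer)
    (hdist : ∀ v : HeightOneSpectrum (𝓞 F), (p : 𝓞 F) ∈ v.asIdeal → 𝒟.IsDistinguishedAt v) :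
    Nonempty 𝒟.RigidData := by
  classical
  obtain ⟨v₀, hv₀⟩ := exists_heightOneSpectrum_mem (F := F) hp
  obtain ⟨σ₀, hσ₀⟩ := hdist v₀ hv₀
  have hk : Function.Surjective (algebraMap 𝒪 k) := 𝒟.residueMap_surjective
  -- the residual matrix at `σ₀` in the residual frame and its eigenframe over `k`
  set Mbar : Matrix (Fin 2) (Fin 2) k := ((𝒟.frame v₀)⁻¹ *
    𝒟.residual (absGaloisRestrict F (v₀.adicCompletion F) σ₀) * 𝒟.frame v₀).val with hMbar
  have h10 : (RingHom.id k) (Mbar 1 0) = 0 := 𝒟.frame_spec v₀ hv₀ σ₀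
  have hne : (RingHom.id k) (Mbar 0 0) ≠ (RingHom.id k) (Mbar 1 1) := hσ₀
  have hδ : (RingHom.id k) (Mbar 1 1) = (RingHom.id k) (Mbar 1 1) := rfl
  have hroot : IsCharRoot Mbar (Mbar 1 1) := isCharRoot_of_lowerLeft_eq_zero h10
  set cbar := eigenFrameGL (π := RingHom.id k) Function.surjective_id h10 hne hδ with hcbar
  set Ebar := 𝒟.frame v₀ * cbar with hEbar
  obtain ⟨E, hE⟩ := exists_generalLinearGroup_map_eq (π := algebraMap 𝒪 k) hk Ebar
  -- the conjugated residual representation and its value at `σ₀`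
  have hconj : ∀ γ, 𝒟.conjResidual E γ = Ebar⁻¹ * 𝒟.residual γ * Ebar := fun γ => by
    rw [conjResidual_apply, hE]
  have hg₀ : (𝒟.conjResidual E (absGaloisRestrict F (v₀.adicCompletion F) σ₀)).val =
      Matrix.diagonal ![Mbar 0 0 + Mbar 1 1 - Mbar 1 1, Mbar 1 1] := by
    rw [hconj, hEbar, ← eigenFrameGL_inv_mul_mul (π := RingHom.id k) Function.surjective_id h10 hne hδ hroot,
      ← hcbar, hMbar]
    simp only [_root_.mul_inv_rev, Units.val_mul]
    simp only [Matrix.mul_assoc]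
  -- an off-diagonal entry of the conjugated residual representation is non-zero
  have hoff : ∃ (τ : absoluteGaloisGroup F) (i j : Fin 2), i ≠ j ∧ (𝒟.conjResidual E τ).val i j ≠ 0 := by
    by_contra hnot
    have hall : ∀ (τ : absoluteGaloisGroup F) (i j : Fin 2), i ≠ j → (𝒟.conjResidual E τ).val i j = 0 := by
      intro τ i j hij
      by_contra hne'
      exact hnot ⟨τ, i, j, hij, hne'⟩
    -- then `Ebar diag(1,0) Ebar⁻¹` commutes with `ρ̄` and is not scalar
    have hdiag : ∀ γ, ∃ a b : k, (𝒟.conjResidual E γ).val = Matrix.diagonal ![a, b] := by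
      intro γ
      refine ⟨(𝒟.conjResidual E γ).val 0 0, (𝒟.conjResidual E γ).val 1 1, ?_⟩
      ext i j
      fin_cases i <;> fin_cases j
      · rfl
      · exact hall γ 0 1 (by decide)
      · exact hall γ 1 0 (by decide)
      · rfl
    set N : Matrix (Fin 2) (Fin 2) k := Ebar.val * Matrix.diagonal ![1, 0] * (Ebar⁻¹).val with hN
    have hcomm : ∀ γ, N * (𝒟.residual γ).val = (𝒟.residual γ).val * N := by
      intro γ
      obtain ⟨a, b, hab⟩ := hdiag γ
      have hρ' : 𝒟.residual γ = Ebar * 𝒟.conjResidual E γ * Ebar⁻¹ := by rw [hconj]; group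
      have hρ : (𝒟.residual γ).val = Ebar.val * Matrix.diagonal ![a, b] * (Ebar⁻¹).val := by
        rw [hρ', Units.val_mul, Units.val_mul, hab]
      rw [hρ, hN]
      have hEE : (Ebar⁻¹).val * Ebar.val = 1 := by rw [← Units.val_mul, inv_mul_cancel, Units.val_one]
      calc Ebar.val * Matrix.diagonal ![1, 0] * (Ebar⁻¹).val * (Ebar.val * Matrix.diagonal ![a, b] * (Ebar⁻¹).val)
          = Ebar.val * (Matrix.diagonal ![1, 0] * ((Ebar⁻¹).val * Ebar.val) * Matrix.diagonal ![a, b]) *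
              (Ebar⁻¹).val := by simp only [Matrix.mul_assoc]
        _ = Ebar.val * (Matrix.diagonal ![a, b] * ((Ebar⁻¹).val * Ebar.val) * Matrix.diagonal ![1, 0]) *
              (Ebar⁻¹).val := by
            rw [hEE, Matrix.mul_one, Matrix.mul_one, Matrix.diagonal_mul_diagonal,
              Matrix.diagonal_mul_diagonal]
            congr 2
            funext i; fin_cases i <;> simp [mul_comm]
        _ = Ebar.val * Matrix.diagonal ![a, b] * (Ebar⁻¹).val * (Ebar.val * Matrix.diagonal ![1, 0] *
              (Ebar⁻¹).val) := by simp only [Matrix.mul_assoc]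
    obtain ⟨c, hc⟩ := hsc N hcomm
    have h1 : Matrix.diagonal ![(1 : k), 0] = c • (1 : Matrix (Fin 2) (Fin 2) k) := by
      have := congrArg (fun X => (Ebar⁻¹).val * X * Ebar.val) hc
      simp only [hN] at this
      have hEE : (Ebar⁻¹).val * Ebar.val = 1 := by rw [← Units.val_mul, inv_mul_cancel, Units.val_one]
      rw [show (Ebar⁻¹).val * (Ebar.val * Matrix.diagonal ![1, 0] * (Ebar⁻¹).val) * Ebar.val =
          ((Ebar⁻¹).val * Ebar.val) * Matrix.diagonal ![1, 0] * ((Ebar⁻¹).val * Ebar.val) by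
            simp only [Matrix.mul_assoc], hEE, Matrix.one_mul, Matrix.mul_one] at this
      rw [this, Matrix.mul_smul, Matrix.smul_mul, Matrix.mul_one, hEE]
    have h00 := congrFun (congrFun h1 0) 0
    have h11 := congrFun (congrFun h1 1) 1
    simp at h00 h11
    exact one_ne_zero (h00.trans h11.symm)
  obtain ⟨τ, i₀, j₀, hij, hτ⟩ := hoff
  obtain ⟨t, ht⟩ := hk ((𝒟.conjResidual E τ).val i₀ j₀)
  -- frame lifts and distinguished witnesses at all places
  choose Fv hFv using fun v => exists_generalLinearGroup_map_eq (π := algebraMap 𝒪 k) hk (𝒟.frame v)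
  let σv : ∀ v : HeightOneSpectrum (𝓞 F), absoluteGaloisGroup (v.adicCompletion F) := fun v =>
    if h : (p : 𝓞 F) ∈ v.asIdeal then (hdist v h).choose else 1
  have hσv : ∀ v (h : (p : 𝓞 F) ∈ v.asIdeal), σv v = (hdist v h).choose := fun v h => dif_pos h
  have hσv' : ∀ v, (p : 𝓞 F) ∈ v.asIdeal →
      ((𝒟.frame v)⁻¹ * 𝒟.residual (absGaloisRestrict F (v.adicCompletion F) (σv v)) * 𝒟.frame v).val 0 0 ≠
      ((𝒟.frame v)⁻¹ * 𝒟.residual (absGaloisRestrict F (v.adicCompletion F) (σv v)) * 𝒟.frame v).val 1 1 := by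
    intro v hv
    rw [hσv v hv]
    exact (hdist v hv).choose_spec
  have h01 : (𝒟.conjResidual E (absGaloisRestrict F (v₀.adicCompletion F) σ₀)).val 0 1 = 0 := by
    rw [hg₀]; simp [Matrix.diagonal]
  have h10' : (𝒟.conjResidual E (absGaloisRestrict F (v₀.adicCompletion F) σ₀)).val 1 0 = 0 := by
    rw [hg₀]; simp [Matrix.diagonal]
  have hne' : (𝒟.conjResidual E (absGaloisRestrict F (v₀.adicCompletion F) σ₀)).val 0 0 ≠
      (𝒟.conjResidual E (absGaloisRestrict F (v₀.adicCompletion F) σ₀)).val 1 1 := by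
    rw [hg₀]
    simp [Matrix.diagonal]
    exact hne
  exact ⟨⟨E, absGaloisRestrict F (v₀.adicCompletion F) σ₀, h01, h10', hne', i₀, j₀, hij, τ, t, ht, hτ,
    Fv, fun v _ => hFv v, σv, hσv'⟩⟩

/-! ### Near-ordinarity: rigid form versus frames -/

namespace RigidData

variable {𝒟} (R : 𝒟.RigidData) {A : Type} [CommRing A] [IsLocalRing A] [Algebra 𝒪 A]
  {π : A →+* k} (hπ : Function.Surjective π) (hπo : ∀ o, π (algebraMap 𝒪 A o) = algebraMap 𝒪 k o)

omit [IsLocalRing 𝒪] [IsLocalRing A] in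
/-- The first column of `G_v · eigenFrame(M_v, δ)` is the special vector `x_v`. [folklore] -/
theorem xv_eq_col (ρ : absoluteGaloisGroup F →* GL (Fin 2) A) (v : HeightOneSpectrum (𝓞 F)) (δ : A) (i : Fin 2) :
    R.xv ρ v δ i = ((R.Gv A v).val * eigenFrame (R.Mv ρ v) δ) i 0 := by
  simp only [xv, Matrix.mulVec, dotProduct, Fin.sum_univ_two, Matrix.mul_apply, Matrix.cons_val_zero,
    Matrix.cons_val_one, eigenFrame_apply_00, eigenFrame_apply_10]

omit [IsLocalRing 𝒪] in
include hπ hπo in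
/-- **Rigid near-ordinarity versus frames** (for a lift of the conjugated residual representation
over a Henselian `A`): `NOAt` holds iff some frame `Q` with `π Q₁₀ = 0` makes all
`Q⁻¹ (G_v⁻¹ ρ(σ) G_v) Q` upper triangular. [cite: CalegariMazur2008, Def. 2.2–2.3] -/
theorem noAt_iff_exists_frame [HenselianRing A (maximalIdeal A)] {ρ : absoluteGaloisGroup F →* GL (Fin 2) A}
    (hres : (Matrix.GeneralLinearGroup.map π).comp ρ = 𝒟.conjResidual R.E)
    (v : HeightOneSpectrum (𝓞 F)) (hv : (p : 𝓞 F) ∈ v.asIdeal) :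
    R.NOAt π ρ v ↔ ∃ Q : GL (Fin 2) A, π (Q.val 1 0) = 0 ∧
      ∀ σ, ((Q⁻¹).val * ((R.Gv A v)⁻¹ * ρ (absGaloisRestrict F (v.adicCompletion F) σ) * R.Gv A v).val *
        Q.val) 1 0 = 0 := by
  obtain ⟨h10, hne⟩ := R.residue_Mv_lowerLeft hπo hres v hv
  obtain ⟨δ₀, hδ₀, hroot₀⟩ := exists_isCharRoot hπ (R.Mv ρ v) h10 hne
  -- key identity: `Q⁻¹ (Gv⁻¹ ρ Gv) Q = (Gv Q)⁻¹ ρ (Gv Q)`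
  have hkey : ∀ (Q : GL (Fin 2) A) σ,
      (Q⁻¹).val * ((R.Gv A v)⁻¹ * ρ (absGaloisRestrict F (v.adicCompletion F) σ) * R.Gv A v).val * Q.val =
      ((R.Gv A v * Q)⁻¹).val * (ρ (absGaloisRestrict F (v.adicCompletion F) σ)).val * (R.Gv A v * Q).val := by
    intro Q σ
    simp only [_root_.mul_inv_rev, Units.val_mul, Matrix.mul_assoc]
  -- the canonical frame condition is `NOAt` with root `δ₀`
  have hcanon : (∀ σ, det2 (R.xv ρ v δ₀) ((ρ (absGaloisRestrict F (v.adicCompletion F) σ)).val *ᵥ R.xv ρ v δ₀) = 0) ↔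
      ∀ σ, (((eigenFrameGL hπ h10 hne hδ₀)⁻¹).val * ((R.Gv A v)⁻¹ * ρ (absGaloisRestrict F (v.adicCompletion F) σ) *
        R.Gv A v).val * (eigenFrameGL hπ h10 hne hδ₀).val) 1 0 = 0 := by
    refine forall_congr' fun σ => ?_
    rw [hkey, lowerLeft_eq_zero_iff_det2]
    have hx : (fun i => (R.Gv A v * eigenFrameGL hπ h10 hne hδ₀).val i 0) = R.xv ρ v δ₀ := by
      funext i; rw [xv_eq_col, Units.val_mul]; rfl
    have hy : (fun i => ((ρ (absGaloisRestrict F (v.adicCompletion F) σ)).val *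
        (R.Gv A v * eigenFrameGL hπ h10 hne hδ₀).val) i 0) =
        (ρ (absGaloisRestrict F (v.adicCompletion F) σ)).val *ᵥ R.xv ρ v δ₀ := by
      funext i
      rw [← hx]
      simp only [Matrix.mul_apply, Matrix.mulVec, dotProduct]
    rw [hx, hy]
  constructor
  · rintro ⟨δ, hδ, hroot, hdet⟩
    have hδδ : δ = δ₀ := IsCharRoot.unique hπ hne hroot hroot₀ hδ hδ₀
    subst hδδ
    exact ⟨eigenFrameGL hπ h10 hne hδ, h10, hcanon.1 hdet⟩
  · rintro ⟨Q, hQ, hup⟩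
    refine ⟨δ₀, hδ₀, hroot₀, hcanon.2 ?_⟩
    exact (exists_frame_iff_eigenFrameGL hπ h10 hne hδ₀ hroot₀
      (fun σ => ((R.Gv A v)⁻¹ * ρ (absGaloisRestrict F (v.adicCompletion F) σ) * R.Gv A v).val)
      ⟨R.σv v, rfl⟩).1 ⟨Q, hQ, hup⟩

omit [IsLocalRing 𝒪] in
include hπ hπo in
/-- Rigid near-ordinarity is invariant under strict equivalence. [folklore] -/
theorem NOAt.of_isStrictEquiv [HenselianRing A (maximalIdeal A)] {ρ ρ' : absoluteGaloisGroup F →* GL (Fin 2) A}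
    (hres : (Matrix.GeneralLinearGroup.map π).comp ρ = 𝒟.conjResidual R.E)
    (hres' : (Matrix.GeneralLinearGroup.map π).comp ρ' = 𝒟.conjResidual R.E)
    (e : IsStrictEquiv π ρ ρ') {v : HeightOneSpectrum (𝓞 F)} (hv : (p : 𝓞 F) ∈ v.asIdeal)
    (h : R.NOAt π ρ v) : R.NOAt π ρ' v := by
  rw [R.noAt_iff_exists_frame hπ hπo hres v hv] at h
  rw [R.noAt_iff_exists_frame hπ hπo hres' v hv]
  obtain ⟨Q, hQ, hup⟩ := h
  obtain ⟨P, hP, hρ'⟩ := e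
  -- new frame `Gv⁻¹ P Gv Q`
  refine ⟨(R.Gv A v)⁻¹ * P * R.Gv A v * Q, ?_, fun σ => ?_⟩
  · have h1 : Matrix.GeneralLinearGroup.map π ((R.Gv A v)⁻¹ * P * R.Gv A v * Q) =
        Matrix.GeneralLinearGroup.map π Q := by
      rw [map_mul, map_mul, map_mul, map_inv, hP, mul_one, inv_mul_cancel, one_mul]
    have h2 := Matrix.GeneralLinearGroup.map_apply π 1 0 ((R.Gv A v)⁻¹ * P * R.Gv A v * Q)
    rw [h1, Matrix.GeneralLinearGroup.map_apply] at h2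
    rw [← h2, hQ]
  · rw [hρ']
    have hid : ((R.Gv A v)⁻¹ * P * R.Gv A v * Q)⁻¹ * ((R.Gv A v)⁻¹ * (P * ρ (absGaloisRestrict F (v.adicCompletion F) σ) * P⁻¹) *
        R.Gv A v) * ((R.Gv A v)⁻¹ * P * R.Gv A v * Q) =
        Q⁻¹ * ((R.Gv A v)⁻¹ * ρ (absGaloisRestrict F (v.adicCompletion F) σ) * R.Gv A v) * Q := by group
    have := congrArg (fun X : GL (Fin 2) A => X.val 1 0) hid
    simp only [Units.val_mul] at this
    rw [Units.val_mul, Units.val_mul] 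
    simp only [Units.val_mul] at hup ⊢
    rw [this]
    exact hup σ

/-! ### Conjugation, diagonal frames -/

omit [IsLocalRing 𝒪] [NumberField F] [IsLocalRing A] in
/-- Conjugating a lift by `P` with `π P = 1` is a strict equivalence. [folklore] -/
theorem isStrictEquiv_conj (P : GL (Fin 2) A) (hP : Matrix.GeneralLinearGroup.map π P = 1)
    (ρ : absoluteGaloisGroup F →* GL (Fin 2) A) :
    IsStrictEquiv π ρ ((MulAut.conj P).toMonoidHom.comp ρ) :=
  ⟨P, hP, fun γ => by simp⟩

omit [IsLocalRing 𝒪] [NumberField F] in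
/-- Continuity is invariant under conjugation. [folklore] -/
theorem isAdicContinuous_conj (P : GL (Fin 2) A) {ρ : absoluteGaloisGroup F →* GL (Fin 2) A}
    (h : IsAdicContinuous ρ) : IsAdicContinuous ((MulAut.conj P).toMonoidHom.comp ρ) := by
  intro m
  have hker : ((Matrix.GeneralLinearGroup.map (Ideal.Quotient.mk (maximalIdeal A ^ m))).comp
      ((MulAut.conj P).toMonoidHom.comp ρ)).ker =
      ((Matrix.GeneralLinearGroup.map (Ideal.Quotient.mk (maximalIdeal A ^ m))).comp ρ).ker := by
    ext γ
    simp only [MonoidHom.mem_ker, MonoidHom.comp_apply, MulEquiv.coe_toMonoidHom, MulAut.conj_apply, map_mul,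
      map_inv]
    rw [mul_inv_eq_one, mul_eq_left]
  rw [hker]; exact h m

omit [IsLocalRing 𝒪] [NumberField F] [IsLocalRing A] in
/-- The residual representation is invariant under conjugation by `P ≡ 1`. [folklore] -/
theorem residual_conj (P : GL (Fin 2) A) (hP : Matrix.GeneralLinearGroup.map π P = 1)
    (ρ : absoluteGaloisGroup F →* GL (Fin 2) A) :
    (Matrix.GeneralLinearGroup.map π).comp ((MulAut.conj P).toMonoidHom.comp ρ) =
      (Matrix.GeneralLinearGroup.map π).comp ρ := by
  refine MonoidHom.ext fun γ => ?_
  simp [map_mul, map_inv, hP]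

/-- A diagonal element of `GL₂(A)` with unit entries. [folklore] -/
def diagGL (d : Fin 2 → Aˣ) : GL (Fin 2) A where
  val := Matrix.diagonal fun i => (d i : A)
  inv := Matrix.diagonal fun i => ((d i)⁻¹ : Aˣ)
  val_inv := by rw [Matrix.diagonal_mul_diagonal, ← Matrix.diagonal_one]; congr 1; funext i; simp
  inv_val := by rw [Matrix.diagonal_mul_diagonal, ← Matrix.diagonal_one]; congr 1; funext i; simp

omit [IsLocalRing 𝒪] [IsLocalRing A] [Algebra 𝒪 A] in
/-- Conjugation by a diagonal matrix rescales the entries: `(D⁻¹ X D)ᵢⱼ = dᵢ⁻¹ Xᵢⱼ dⱼ`. [folklore] -/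
theorem diagGL_inv_mul_mul_apply (d : Fin 2 → Aˣ) (X : Matrix (Fin 2) (Fin 2) A) (i j : Fin 2) :
    (((diagGL d)⁻¹).val * X * (diagGL d).val) i j = ((d i)⁻¹ : Aˣ) * X i j * d j := by
  change ((Matrix.diagonal fun i => (((d i)⁻¹ : Aˣ) : A)) * X * Matrix.diagonal fun i => (d i : A)) i j = _
  rw [Matrix.mul_diagonal, Matrix.diagonal_mul]

/-! ### Uniqueness of the rigid representative -/

omit [IsLocalRing 𝒪] in
include hπ hπo in
/-- **Two strictly equivalent rigid lifts are equal**: a conjugating matrix `P ≡ 1` commutes with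
the diagonal `ρ(g₀)` (whose diagonal entries have unit difference), hence is diagonal, hence scalar by
the normalisation at `τ`. [cite: SkinnerWiles1999, §2.1] -/
theorem rigid_unique {ρ₁ ρ₂ : absoluteGaloisGroup F →* GL (Fin 2) A} (h₁ : R.IsRigidLift π ρ₁)
    (h₂ : R.IsRigidLift π ρ₂) (e : IsStrictEquiv π ρ₁ ρ₂) : ρ₁ = ρ₂ := by
  obtain ⟨P, hP, hconj⟩ := e
  have hres : ∀ {ρ : absoluteGaloisGroup F →* GL (Fin 2) A}, R.IsRigidLift π ρ → ∀ a b,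
      π ((ρ R.g₀).val a b) = (𝒟.conjResidual R.E R.g₀).val a b := by
    intro ρ h a b
    have h1 := DFunLike.congr_fun h.residual_eq R.g₀
    rw [MonoidHom.comp_apply] at h1
    have h2 := Matrix.GeneralLinearGroup.map_apply π a b (ρ R.g₀)
    rw [h1] at h2; exact h2.symm
  set M₁ := (ρ₁ R.g₀).val with hM₁
  set M₂ := (ρ₂ R.g₀).val with hM₂
  have hne : π (M₁ 0 0) ≠ π (M₁ 1 1) := by rw [hres h₁, hres h₁]; exact R.g₀_ne
  have hne₂ : π (M₂ 0 0) ≠ π (M₂ 1 1) := by rw [hres h₂, hres h₂]; exact R.g₀_ne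
  have hM₂P : M₂ = P.val * M₁ * (P⁻¹).val := by rw [hM₂, hconj R.g₀, Units.val_mul, Units.val_mul]
  have htr : M₂ 0 0 + M₂ 1 1 = M₁ 0 0 + M₁ 1 1 := by
    have := Matrix.trace_units_conj P M₁
    rw [← hM₂P, Matrix.trace_fin_two, Matrix.trace_fin_two] at this; exact this
  have hdet : M₂.det = M₁.det := by rw [hM₂P]; exact Matrix.det_units_conj P M₁
  have hroot₁ : IsCharRoot M₁ (M₁ 1 1) := isCharRoot_of_lowerLeft_eq_zero h₁.diag_10
  have hroot₂ : IsCharRoot M₂ (M₂ 1 1) := isCharRoot_of_lowerLeft_eq_zero h₂.diag_10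
  have hroot₂' : IsCharRoot M₂ (M₁ 1 1) := by
    unfold IsCharRoot at hroot₁ ⊢
    rw [htr, ← Matrix.det_fin_two, hdet, Matrix.det_fin_two]; exact hroot₁
  have h11 : M₁ 1 1 = M₂ 1 1 :=
    IsCharRoot.unique hπ hne₂ hroot₂' hroot₂ (by rw [hres h₁, hres h₂]) rfl
  have h00 : M₁ 0 0 = M₂ 0 0 := by linear_combination (-1 : A) * htr - h11
  have hMeq : M₁ = M₂ := by
    ext a b; fin_cases a <;> fin_cases b
    · exact h00
    · exact h₁.diag_01.trans h₂.diag_01.symm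
    · exact h₁.diag_10.trans h₂.diag_10.symm
    · exact h11
  have hPM : P.val * M₁ = M₁ * P.val := by
    have : M₂ * P.val = P.val * M₁ := by
      rw [hM₂P]
      simp only [Matrix.mul_assoc]
      rw [← Units.val_mul P⁻¹ P, inv_mul_cancel, Units.val_one, Matrix.mul_one]
    rw [← this, hMeq]
  have hunit : IsUnit (M₁ 1 1 - M₁ 0 0) := by
    rw [isUnit_iff_residue_ne_zero hπ, map_sub, sub_ne_zero]; exact hne.symm
  have hM01 : M₁ 0 1 = 0 := h₁.diag_01
  have hM10 : M₁ 1 0 = 0 := h₁.diag_10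
  have hP01 : P.val 0 1 = 0 := by
    have h := congrFun (congrFun hPM 0) 1
    simp only [Matrix.mul_apply, Fin.sum_univ_two, hM01, mul_zero, add_zero, zero_mul,
      zero_add] at h
    have : (M₁ 1 1 - M₁ 0 0) * P.val 0 1 = 0 := by linear_combination h
    exact hunit.mul_right_eq_zero.1 this
  have hP10 : P.val 1 0 = 0 := by
    have h := congrFun (congrFun hPM 1) 0
    simp only [Matrix.mul_apply, Fin.sum_univ_two, hM10, mul_zero, add_zero, zero_mul,
      zero_add] at h
    have : (M₁ 1 1 - M₁ 0 0) * P.val 1 0 = 0 := by linear_combination -h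
    exact hunit.mul_right_eq_zero.1 this
  have hPoff : ∀ a b : Fin 2, a ≠ b → P.val a b = 0 := by
    intro a b hab; fin_cases a <;> fin_cases b
    · exact absurd rfl hab
    · exact hP01
    · exact hP10
    · exact absurd rfl hab
  -- normalisation at `τ`
  have hτ : ρ₂ R.τ * P = P * ρ₁ R.τ := by rw [hconj R.τ, inv_mul_cancel_right]
  have hτe := congrFun (congrFun (congrArg (fun X : GL (Fin 2) A => X.val) hτ) R.i₀) R.j₀
  simp only [Units.val_mul, Matrix.mul_apply] at hτe
  rw [Finset.sum_eq_single R.j₀ (fun l _ hl => by rw [hPoff l _ hl, mul_zero]) (by simp),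
    Finset.sum_eq_single R.i₀ (fun l _ hl => by rw [hPoff _ l (Ne.symm hl), zero_mul]) (by simp),
    h₂.entry_eq, h₁.entry_eq, mul_comm (P.val R.i₀ R.i₀)] at hτe
  have htunit : IsUnit (algebraMap 𝒪 A R.t) := by
    rw [isUnit_iff_residue_ne_zero hπ, hπo, R.t_spec]; exact R.t_ne
  have hkey : P.val R.j₀ R.j₀ = P.val R.i₀ R.i₀ := htunit.mul_left_cancel hτe
  have hdiagP : P.val 0 0 = P.val 1 1 := by
    have aux : ∀ i j : Fin 2, i ≠ j → P.val j j = P.val i i → P.val 0 0 = P.val 1 1 := by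
      intro i j hij h; fin_cases i <;> fin_cases j
      · exact absurd rfl hij
      · exact h.symm
      · exact h
      · exact absurd rfl hij
    exact aux _ _ R.i₀_ne_j₀ hkey
  have hPs : P.val = P.val 0 0 • (1 : Matrix (Fin 2) (Fin 2) A) := by
    ext a b; fin_cases a <;> fin_cases b <;> simp [hP01, hP10, hdiagP]
  refine MonoidHom.ext fun γ => ?_
  have hcomm : P * ρ₁ γ = ρ₁ γ * P := Units.ext (by
    rw [Units.val_mul, Units.val_mul, hPs, Matrix.smul_mul, Matrix.mul_smul, Matrix.one_mul, Matrix.mul_one])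
  rw [hconj γ, hcomm, mul_inv_cancel_right]

/-! ### Existence of the rigid representative -/

omit [IsLocalRing 𝒪] [IsLocalRing A] [Algebra 𝒪 A] in
/-- Entries of a lift reduce to entries of the conjugated residual representation. [folklore] -/
theorem residue_apply_of_residual_eq {ρ : absoluteGaloisGroup F →* GL (Fin 2) A}
    (hres : (Matrix.GeneralLinearGroup.map π).comp ρ = 𝒟.conjResidual R.E) (γ : absoluteGaloisGroup F)
    (a b : Fin 2) : π ((ρ γ).val a b) = (𝒟.conjResidual R.E γ).val a b := by
  have h1 := DFunLike.congr_fun hres γ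
  rw [MonoidHom.comp_apply] at h1
  have h2 := Matrix.GeneralLinearGroup.map_apply π a b (ρ γ)
  rw [h1] at h2; exact h2.symm

omit [IsLocalRing 𝒪] in
include hπ hπo in
/-- **Rigidification**: every continuous lift of `Ē⁻¹ ρ̄ Ē` over a Henselian `A`, unramified outside `S`
and nearly ordinary above `p`, is strictly equivalent to a rigid lift. [cite: SkinnerWiles1999, §2.1] -/
theorem exists_rigid [HenselianRing A (maximalIdeal A)] {ρ : absoluteGaloisGroup F →* GL (Fin 2) A}
    (hcont : IsAdicContinuous ρ) (hres : (Matrix.GeneralLinearGroup.map π).comp ρ = 𝒟.conjResidual R.E)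
    (hunr : ∀ v ∉ 𝒟.S, IsUnramifiedAt v ρ)
    (hno : ∀ v : HeightOneSpectrum (𝓞 F), (p : 𝓞 F) ∈ v.asIdeal → R.NOAt π ρ v) :
    ∃ ρr, R.IsRigidLift π ρr ∧ IsStrictEquiv π ρ ρr := by
  -- invariance of the non-rigid conditions under conjugation by `P ≡ 1`
  have hinv : ∀ {ρ' : absoluteGaloisGroup F →* GL (Fin 2) A} (P : GL (Fin 2) A),
      Matrix.GeneralLinearGroup.map π P = 1 → IsAdicContinuous ρ' →
      (Matrix.GeneralLinearGroup.map π).comp ρ' = 𝒟.conjResidual R.E → (∀ v ∉ 𝒟.S, IsUnramifiedAt v ρ') →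
      (∀ v : HeightOneSpectrum (𝓞 F), (p : 𝓞 F) ∈ v.asIdeal → R.NOAt π ρ' v) →
      IsAdicContinuous ((MulAut.conj P).toMonoidHom.comp ρ') ∧
      (Matrix.GeneralLinearGroup.map π).comp ((MulAut.conj P).toMonoidHom.comp ρ') = 𝒟.conjResidual R.E ∧
      (∀ v ∉ 𝒟.S, IsUnramifiedAt v ((MulAut.conj P).toMonoidHom.comp ρ')) ∧
      (∀ v : HeightOneSpectrum (𝓞 F), (p : 𝓞 F) ∈ v.asIdeal → R.NOAt π ((MulAut.conj P).toMonoidHom.comp ρ') v) := by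
    intro ρ' P hP hc hr hu hn
    have hr' : (Matrix.GeneralLinearGroup.map π).comp ((MulAut.conj P).toMonoidHom.comp ρ') =
        𝒟.conjResidual R.E := by rw [residual_conj P hP, hr]
    refine ⟨isAdicContinuous_conj P hc, hr', fun v hv 𝔓 h𝔓 σ hσ => ?_, fun v hv => ?_⟩
    · simp [hu v hv 𝔓 h𝔓 σ hσ]
    · exact NOAt.of_isStrictEquiv R hπ hπo hr hr' (isStrictEquiv_conj P hP ρ') hv (hn v hv)
  -- Step 1: diagonalise `ρ(g₀)`
  set M := (ρ R.g₀).val with hM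
  have hM10 : π (M 1 0) = 0 := by rw [residue_apply_of_residual_eq R hres]; exact R.g₀_10
  have hM01 : π (M 0 1) = 0 := by rw [residue_apply_of_residual_eq R hres]; exact R.g₀_01
  have hne : π (M 0 0) ≠ π (M 1 1) := by
    rw [residue_apply_of_residual_eq R hres, residue_apply_of_residual_eq R hres]; exact R.g₀_ne
  obtain ⟨δ, hδ, hroot⟩ := exists_isCharRoot hπ M hM10 hne
  set C := eigenFrameGL hπ hM10 hne hδ with hC
  have hC00 : IsUnit (C.val 0 0) := by
    rw [isUnit_iff_residue_ne_zero hπ]; change π (eigenFrame M δ 0 0) ≠ 0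
    rw [eigenFrame_apply_00, map_sub, hδ, sub_ne_zero]; exact hne
  have hC11 : IsUnit (C.val 1 1) := by
    rw [isUnit_iff_residue_ne_zero hπ]; change π (eigenFrame M δ 1 1) ≠ 0
    rw [eigenFrame_apply_11, map_sub, hδ, sub_ne_zero]; exact hne.symm
  let dC : Fin 2 → Aˣ := fun i => if i = 0 then hC00.unit else hC11.unit
  have hdC : ∀ i, (dC i : A) = C.val i i := by
    intro i; fin_cases i <;> simp [dC]
  set P₁ : GL (Fin 2) A := diagGL dC * C⁻¹ with hP₁def
  have hP₁ : Matrix.GeneralLinearGroup.map π P₁ = 1 := by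
    -- `π(C) = diag(π C₀₀, π C₁₁)` since the off-diagonal entries of `C` reduce to `0`
    have hCres : Matrix.GeneralLinearGroup.map π C = Matrix.GeneralLinearGroup.map π (diagGL dC) := by
      apply Units.ext; ext a b
      rw [Matrix.GeneralLinearGroup.map_apply, Matrix.GeneralLinearGroup.map_apply]
      change π (eigenFrame M δ a b) = π ((Matrix.diagonal fun i => (dC i : A)) a b)
      fin_cases a <;> fin_cases b
      · rw [Matrix.diagonal_apply_eq, hdC]; rfl
      · change π (M 0 1) = π ((Matrix.diagonal fun i => (dC i : A)) 0 1)
        rw [hM01, Matrix.diagonal_apply_ne _ (by decide), map_zero]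
      · change π (M 1 0) = π ((Matrix.diagonal fun i => (dC i : A)) 1 0)
        rw [hM10, Matrix.diagonal_apply_ne _ (by decide), map_zero]
      · rw [Matrix.diagonal_apply_eq, hdC]; rfl
    rw [hP₁def, map_mul, map_inv, hCres, mul_inv_cancel]
  set ρ₁ := (MulAut.conj P₁).toMonoidHom.comp ρ with hρ₁
  obtain ⟨hc₁, hr₁, hu₁, hn₁⟩ := hinv P₁ hP₁ hcont hres hunr hno
  have hρ₁g₀ : (ρ₁ R.g₀).val = Matrix.diagonal fun i => (Matrix.diagonal ![M 0 0 + M 1 1 - δ, δ]) i i := by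
    have hdiag := eigenFrameGL_inv_mul_mul hπ hM10 hne hδ hroot
    rw [← hC] at hdiag
    have : (ρ₁ R.g₀).val = (diagGL dC).val * ((C⁻¹).val * M * C.val) * ((diagGL dC)⁻¹).val := by
      simp only [hρ₁, MonoidHom.comp_apply, MulEquiv.coe_toMonoidHom, MulAut.conj_apply, hP₁def,
        _root_.mul_inv_rev, inv_inv, Units.val_mul, Matrix.mul_assoc, hM]
    rw [this, hdiag]
    change (Matrix.diagonal fun i => (dC i : A)) * Matrix.diagonal ![M 0 0 + M 1 1 - δ, δ] *
      (Matrix.diagonal fun i => (((dC i)⁻¹ : Aˣ) : A)) = _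
    rw [Matrix.diagonal_mul_diagonal, Matrix.diagonal_mul_diagonal]
    congr 1; funext i
    rw [Matrix.diagonal_apply_eq, mul_comm ((dC i : A)), mul_assoc, Units.mul_inv, mul_one]
  have hρ₁01 : (ρ₁ R.g₀).val 0 1 = 0 := by rw [hρ₁g₀, Matrix.diagonal_apply_ne _ (by decide)]
  have hρ₁10 : (ρ₁ R.g₀).val 1 0 = 0 := by rw [hρ₁g₀, Matrix.diagonal_apply_ne _ (by decide)]
  -- Step 2: normalise the `(i₀, j₀)` entry of `ρ₁(τ)`
  have htunit : IsUnit (algebraMap 𝒪 A R.t) := by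
    rw [isUnit_iff_residue_ne_zero hπ, hπo, R.t_spec]; exact R.t_ne
  have hsunit : IsUnit ((ρ₁ R.τ).val R.i₀ R.j₀) := by
    rw [isUnit_iff_residue_ne_zero hπ, residue_apply_of_residual_eq R hr₁]; exact R.t_ne
  let u : Aˣ := hsunit.unit * htunit.unit⁻¹
  have hu : π (u : A) = 1 := by
    have h1 : π ((ρ₁ R.τ).val R.i₀ R.j₀) = π (algebraMap 𝒪 A R.t) := by
      rw [residue_apply_of_residual_eq R hr₁, hπo, R.t_spec]
    have h2 : (u : A) * algebraMap 𝒪 A R.t = (ρ₁ R.τ).val R.i₀ R.j₀ := by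
      change (hsunit.unit : A) * ((htunit.unit⁻¹ : Aˣ) : A) * algebraMap 𝒪 A R.t = _
      rw [mul_assoc, show ((htunit.unit⁻¹ : Aˣ) : A) * algebraMap 𝒪 A R.t = 1 from htunit.unit.inv_mul]
      rw [mul_one]; rfl
    have h3 := congrArg π h2
    rw [map_mul, h1] at h3
    have hπt : π (algebraMap 𝒪 A R.t) ≠ 0 := by rw [hπo, R.t_spec]; exact R.t_ne
    exact mul_left_eq_self₀.1 h3 |>.resolve_right hπt
  let dT : Fin 2 → Aˣ := fun i => if i = R.i₀ then u else 1
  set T : GL (Fin 2) A := diagGL dT with hT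
  have hTπ : Matrix.GeneralLinearGroup.map π T⁻¹ = 1 := by
    rw [map_inv, inv_eq_one]
    apply Units.ext; ext a b
    rw [Matrix.GeneralLinearGroup.map_apply]
    change π ((Matrix.diagonal fun i => (dT i : A)) a b) = (1 : Matrix (Fin 2) (Fin 2) k) a b
    by_cases hab : a = b
    · subst hab
      rw [Matrix.diagonal_apply_eq, Matrix.one_apply_eq]
      simp only [dT]; split_ifs
      · exact hu
      · exact map_one π
    · rw [Matrix.diagonal_apply_ne _ hab, Matrix.one_apply_ne hab, map_zero]
  set ρ₂ := (MulAut.conj T⁻¹).toMonoidHom.comp ρ₁ with hρ₂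
  obtain ⟨hc₂, hr₂, hu₂, hn₂⟩ := hinv T⁻¹ hTπ hc₁ hr₁ hu₁ hn₁
  have hρ₂val : ∀ γ a b, (ρ₂ γ).val a b = ((dT a)⁻¹ : Aˣ) * (ρ₁ γ).val a b * dT b := by
    intro γ a b
    have : (ρ₂ γ).val = (T⁻¹).val * (ρ₁ γ).val * T.val := by
      simp only [hρ₂, MonoidHom.comp_apply, MulEquiv.coe_toMonoidHom, MulAut.conj_apply, inv_inv, Units.val_mul]
    rw [this, hT]; exact diagGL_inv_mul_mul_apply dT _ a b
  refine ⟨ρ₂, ⟨hc₂, hr₂, hu₂, hn₂, ?_, ?_, ?_⟩, ?_⟩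
  · rw [hρ₂val, hρ₁01, mul_zero, zero_mul]
  · rw [hρ₂val, hρ₁10, mul_zero, zero_mul]
  · rw [hρ₂val]
    have hi : dT R.i₀ = u := if_pos rfl
    have hj : dT R.j₀ = 1 := if_neg (Ne.symm R.i₀_ne_j₀)
    rw [hi, hj, Units.val_one, mul_one]
    change (((hsunit.unit * htunit.unit⁻¹)⁻¹ : Aˣ) : A) * (ρ₁ R.τ).val R.i₀ R.j₀ = _
    rw [_root_.mul_inv_rev, inv_inv, Units.val_mul, mul_assoc,
      show (((hsunit.unit)⁻¹ : Aˣ) : A) * (ρ₁ R.τ).val R.i₀ R.j₀ = 1 from hsunit.unit.inv_mul, mul_one]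
    rfl
  · exact (isStrictEquiv_conj P₁ hP₁ ρ).trans (isStrictEquiv_conj T⁻¹ hTπ ρ₁)

end RigidData

end NearlyOrdinaryDatum

/-! ### Conjugation bookkeeping -/

namespace Deformation

variable {Γ : Type*} [Group Γ] {A B : Type*} [CommRing A] [CommRing B] {n : ℕ}

/-- `GL_n(f)` commutes with conjugation. [folklore] -/
theorem map_comp_conj (f : A →+* B) (P : GL (Fin n) A) (ρ : Γ →* GL (Fin n) A) :
    (Matrix.GeneralLinearGroup.map f).comp ((MulAut.conj P).toMonoidHom.comp ρ) =
      (MulAut.conj (Matrix.GeneralLinearGroup.map f P)).toMonoidHom.comp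
        ((Matrix.GeneralLinearGroup.map f).comp ρ) :=
  MonoidHom.ext fun γ => by simp [map_mul, map_inv]

/-- Conjugations compose. [folklore] -/
theorem conj_comp_conj (P Q : GL (Fin n) A) (ρ : Γ →* GL (Fin n) A) :
    (MulAut.conj P).toMonoidHom.comp ((MulAut.conj Q).toMonoidHom.comp ρ) =
      (MulAut.conj (P * Q)).toMonoidHom.comp ρ :=
  MonoidHom.ext fun γ => by simp [mul_assoc]

/-- Conjugation by `1` is the identity. [folklore] -/
theorem conj_one_comp (ρ : Γ →* GL (Fin n) A) : (MulAut.conj 1).toMonoidHom.comp ρ = ρ :=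
  MonoidHom.ext fun γ => by simp

/-- Strict equivalence is preserved by simultaneous conjugation. [folklore] -/
theorem IsStrictEquiv.conj {k : Type*} [CommRing k] {π : A →+* k} {ρ ρ' : Γ →* GL (Fin n) A}
    (h : IsStrictEquiv π ρ ρ') (X : GL (Fin n) A) :
    IsStrictEquiv π ((MulAut.conj X).toMonoidHom.comp ρ) ((MulAut.conj X).toMonoidHom.comp ρ') := by
  obtain ⟨P, hP, hρ⟩ := h
  refine ⟨X * P * X⁻¹, by rw [map_mul, map_mul, map_inv, hP, mul_one, mul_inv_cancel], fun γ => ?_⟩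
  simp only [MonoidHom.comp_apply, MulEquiv.coe_toMonoidHom, MulAut.conj_apply, hρ γ]
  group

end Deformation

/-! ### From the rigid universal ring to the nearly ordinary deformation ring -/

namespace NearlyOrdinaryDatum

open Deformation

variable {F : Type} [Field F] [NumberField F] {p : ℕ} {𝒪 : Type} [CommRing 𝒪] {k : Type}
  [Field k] [Algebra 𝒪 k] {𝒟 : NearlyOrdinaryDatum F p 𝒪 k}

namespace RigidData

variable (R : 𝒟.RigidData)

/-- The kernel of `Ē⁻¹ ρ̄ Ē` is the kernel of `ρ̄`. [folklore] -/
theorem ker_conjResidual : (𝒟.conjResidual R.E).ker = 𝒟.residual.ker := by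
  ext γ
  simp only [MonoidHom.mem_ker, conjResidual_apply]
  rw [mul_assoc, inv_mul_eq_one, eq_comm, mul_eq_right]

/-- Conjugating a lift of `ρ̄` by `E⁻¹` gives a lift of `Ē⁻¹ ρ̄ Ē`. [folklore] -/
theorem residual_conj_EA_inv {A : Type} [CommRing A] [Algebra 𝒪 A] (π : A →ₐ[𝒪] k)
    {ρ : absoluteGaloisGroup F →* GL (Fin 2) A}
    (hres : (Matrix.GeneralLinearGroup.map (π : A →+* k)).comp ρ = 𝒟.residual) :
    (Matrix.GeneralLinearGroup.map (π : A →+* k)).comp ((MulAut.conj (R.EA A)⁻¹).toMonoidHom.comp ρ) =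
      𝒟.conjResidual R.E := by
  rw [map_comp_conj, map_inv, R.map_EA π, hres]; rfl

/-- Conjugating a lift of `Ē⁻¹ ρ̄ Ē` by `E` gives a lift of `ρ̄`. [folklore] -/
theorem residual_conj_EA {A : Type} [CommRing A] [Algebra 𝒪 A] (π : A →ₐ[𝒪] k)
    {ρ : absoluteGaloisGroup F →* GL (Fin 2) A}
    (hres : (Matrix.GeneralLinearGroup.map (π : A →+* k)).comp ρ = 𝒟.conjResidual R.E) :
    (Matrix.GeneralLinearGroup.map (π : A →+* k)).comp ((MulAut.conj (R.EA A)).toMonoidHom.comp ρ) =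
      𝒟.residual := by
  rw [map_comp_conj, R.map_EA π, hres]
  change (MulAut.conj (R.EA k)).toMonoidHom.comp ((MulAut.conj (R.EA k)⁻¹).toMonoidHom.comp 𝒟.residual) = _
  rw [conj_comp_conj, mul_inv_cancel, conj_one_comp]

/-- The residual frame `Ḡ_v = Ē⁻¹ · frame v` at a place above `p`. [folklore] -/
theorem map_Gv_eq {A : Type} [CommRing A] [Algebra 𝒪 A] (π : A →ₐ[𝒪] k) {v : HeightOneSpectrum (𝓞 F)}
    (hv : (p : 𝓞 F) ∈ v.asIdeal) :
    Matrix.GeneralLinearGroup.map (π : A →+* k) (R.Gv A v) = (R.EA k)⁻¹ * 𝒟.frame v := by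
  rw [R.map_Gv π v]
  change Matrix.GeneralLinearGroup.map (algebraMap 𝒪 k) (R.E⁻¹ * R.Fv v) = _
  rw [map_mul, map_inv, R.Fv_spec v hv]; rfl

/-- A lift of `Ē⁻¹ ρ̄ Ē` which is rigid gives, after conjugating by `E`, a lift of `ρ̄` unramified
outside `S`. [folklore] -/
theorem isLift_conj_EA {A : Type} [CommRing A] [IsLocalRing A] [Algebra 𝒪 A] (π : A →ₐ[𝒪] k)
    {ρ : absoluteGaloisGroup F →* GL (Fin 2) A} (h : R.IsRigidLift (π : A →+* k) ρ) :
    𝒟.IsLift π ((MulAut.conj (R.EA A)).toMonoidHom.comp ρ) :=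
  ⟨isAdicContinuous_conj _ h.isAdicContinuous, R.residual_conj_EA π h.residual_eq,
    fun v hv 𝔓 h𝔓 σ hσ => by simp [h.unramified v hv 𝔓 h𝔓 σ hσ]⟩

/-- **Near-ordinarity of a deformation gives rigid near-ordinarity of `E⁻¹ ρ E`.**
[cite: CalegariMazur2008, Def. 2.2–2.3] -/
theorem noAt_of_isNearlyOrdinaryAt {A : Type} [CommRing A] [IsLocalRing A] [Algebra 𝒪 A]
    [HenselianRing A (maximalIdeal A)] (π : A →ₐ[𝒪] k) (hπ : Function.Surjective π)
    {ρ : absoluteGaloisGroup F →* GL (Fin 2) A}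
    (hres : (Matrix.GeneralLinearGroup.map (π : A →+* k)).comp ρ = 𝒟.residual)
    {v : HeightOneSpectrum (𝓞 F)} (hv : (p : 𝓞 F) ∈ v.asIdeal) (h : 𝒟.IsNearlyOrdinaryAt π ρ v) :
    R.NOAt (π : A →+* k) ((MulAut.conj (R.EA A)⁻¹).toMonoidHom.comp ρ) v := by
  have hπo : ∀ o, (π : A →+* k) (algebraMap 𝒪 A o) = algebraMap 𝒪 k o := fun o => π.commutes o
  refine (R.noAt_iff_exists_frame (π := (π : A →+* k)) hπ hπo (R.residual_conj_EA_inv π hres) v hv).2 ?_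
  obtain ⟨P, hP, hup⟩ := h
  refine ⟨(R.Gv A v)⁻¹ * (R.EA A)⁻¹ * P, ?_, fun σ => ?_⟩
  · have h1 : Matrix.GeneralLinearGroup.map (π : A →+* k) ((R.Gv A v)⁻¹ * (R.EA A)⁻¹ * P) =
        (𝒟.frame v)⁻¹ * Matrix.GeneralLinearGroup.map (π : A →+* k) P := by
      rw [map_mul, map_mul, map_inv, map_inv, R.map_Gv_eq π hv, R.map_EA π, _root_.mul_inv_rev, inv_inv,
        mul_inv_cancel_right]
    have h2 := Matrix.GeneralLinearGroup.map_apply (π : A →+* k) 1 0 ((R.Gv A v)⁻¹ * (R.EA A)⁻¹ * P)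
    rw [h1] at h2
    rw [← h2]; exact hP
  · rw [← Units.val_mul, ← Units.val_mul]
    have hid : ((R.Gv A v)⁻¹ * (R.EA A)⁻¹ * P)⁻¹ *
        ((R.Gv A v)⁻¹ * ((MulAut.conj (R.EA A)⁻¹).toMonoidHom.comp ρ) (absGaloisRestrict F (v.adicCompletion F) σ) *
          R.Gv A v) * ((R.Gv A v)⁻¹ * (R.EA A)⁻¹ * P) =
        P⁻¹ * ρ (absGaloisRestrict F (v.adicCompletion F) σ) * P := by
      simp only [MonoidHom.comp_apply, MulEquiv.coe_toMonoidHom, MulAut.conj_apply]; group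
    rw [hid]; exact hup σ

variable [IsNoetherianRing 𝒪] [Finite k]

/-- **The nearly ordinary deformation ring from the rigid universal ring.**  If the rigid lifting
condition `𝒞_𝒟` has finitely many `k[ε]`-points, then `ρ̄` admits a universal nearly ordinary
deformation ring: `R_𝒟` is Mazur's universal ring of `𝒞_𝒟`, `ρ_𝒟 = E ρ_univ E⁻¹`, and the
universal property among deformations follows from rigidification (`exists_rigid`,
`rigid_unique`). [cite: CalegariMazur2008, §2.2] [cite: Mazur1997Deformation, §20 Prop. 2 and §30] -/
theorem nonempty_deformationRing
    (hfin : ((R.liftingCondition 𝒟.residueMap_surjective).carrier (dualCNL 𝒪 k)).Finite) :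
    Nonempty (NearlyOrdinaryDeformationRing.{0} 𝒟) := by
  classical
  have hk := 𝒟.residueMap_surjective
  -- a cofinal sequence of open normal subgroups inside `ker r̄'`
  have hV₀ : IsOpen ((𝒟.conjResidual R.E).ker : Set (absoluteGaloisGroup F)) := by
    rw [ker_conjResidual]; exact 𝒟.isOpen_ker_residual
  obtain ⟨U, hUn, hUo, hUanti, hUle, hUcof⟩ :=
    absoluteGaloisGroup_exists_antitone_openNormal_seq F (𝒟.conjResidual R.E).ker hV₀
  haveI : ∀ N, (U N).Normal := hUn
  haveI : ∀ N, Finite (absoluteGaloisGroup F ⧸ U N) := fun N => Subgroup.quotient_finite_of_isOpen _ (hUo N)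
  have hUo' : ∀ N ⦃H : Subgroup (absoluteGaloisGroup F)⦄, U N ≤ H → IsOpen (H : Set (absoluteGaloisGroup F)) :=
    fun N H hH => Subgroup.isOpen_mono hH (hUo N)
  obtain ⟨Rᵤ, ρu, hρu, huniv⟩ := (R.liftingCondition hk).exists_universal_of_finite hk U hUle hUo' hUanti
    (fun V _ hV => hUcof V hV) hfin
  have hρu' : R.IsRigidLift (Rᵤ.residue : Rᵤ →+* k) ρu := hρu
  have hπo : ∀ o, (Rᵤ.residue : Rᵤ →+* k) (algebraMap 𝒪 Rᵤ o) = algebraMap 𝒪 k o :=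
    fun o => Rᵤ.residue.commutes o
  -- universal nearly ordinary frames
  have hframe : ∀ v : HeightOneSpectrum (𝓞 F), (p : 𝓞 F) ∈ v.asIdeal → ∃ Q : GL (Fin 2) Rᵤ,
      Rᵤ.residue (Q.val 1 0) = 0 ∧ ∀ σ, ((Q⁻¹).val *
        ((R.Gv Rᵤ v)⁻¹ * ρu (absGaloisRestrict F (v.adicCompletion F) σ) * R.Gv Rᵤ v).val * Q.val) 1 0 = 0 :=
    fun v hv => (R.noAt_iff_exists_frame (π := (Rᵤ.residue : Rᵤ →+* k)) Rᵤ.residue_surjective hπo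
      hρu'.residual_eq v hv).1 (hρu'.noAt v hv)
  choose! Q hQ using hframe
  refine ⟨{ R := Rᵤ, π := Rᵤ.residue, π_surjective := Rᵤ.residue_surjective,
            ρ := (MulAut.conj (R.EA Rᵤ)).toMonoidHom.comp ρu,
            isLift := R.isLift_conj_EA Rᵤ.residue hρu',
            noFrame := fun v => R.EA Rᵤ * R.Gv Rᵤ v * Q v,
            noFrame_residual := fun v hv => ?_, noFrame_upper := fun v hv σ => ?_, universal := ?_ }⟩
  · rw [map_mul, map_mul, R.map_Gv_eq Rᵤ.residue hv, R.map_EA Rᵤ.residue, mul_inv_cancel_left,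
      inv_mul_cancel_left, Matrix.GeneralLinearGroup.map_apply]
    exact (hQ v hv).1
  · have h2 := (hQ v hv).2 σ
    rw [← Units.val_mul, ← Units.val_mul] at h2
    have hid : (R.EA Rᵤ * R.Gv Rᵤ v * Q v)⁻¹ *
        ((MulAut.conj (R.EA Rᵤ)).toMonoidHom.comp ρu) (absGaloisRestrict F (v.adicCompletion F) σ) *
        (R.EA Rᵤ * R.Gv Rᵤ v * Q v) =
        (Q v)⁻¹ * ((R.Gv Rᵤ v)⁻¹ * ρu (absGaloisRestrict F (v.adicCompletion F) σ) * R.Gv Rᵤ v) * Q v := by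
      simp only [MonoidHom.comp_apply, MulEquiv.coe_toMonoidHom, MulAut.conj_apply]; group
    rw [hid]; exact h2
  · intro A _ _ _ _ _ πA hπA ρA hdef
    have hπoA : ∀ o, (πA : A →+* k) (algebraMap 𝒪 A o) = algebraMap 𝒪 k o := fun o => πA.commutes o
    -- the rigid-problem lift attached to `ρA`
    have hc' : IsAdicContinuous ((MulAut.conj (R.EA A)⁻¹).toMonoidHom.comp ρA) :=
      isAdicContinuous_conj _ hdef.isAdicContinuous
    have hr' := R.residual_conj_EA_inv πA hdef.residual_eq
    have hu' : ∀ v ∉ 𝒟.S, IsUnramifiedAt v ((MulAut.conj (R.EA A)⁻¹).toMonoidHom.comp ρA) :=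
      fun v hv 𝔓 h𝔓 σ hσ => by simp [hdef.unramified v hv 𝔓 h𝔓 σ hσ]
    have hn' : ∀ v : HeightOneSpectrum (𝓞 F), (p : 𝓞 F) ∈ v.asIdeal →
        R.NOAt (πA : A →+* k) ((MulAut.conj (R.EA A)⁻¹).toMonoidHom.comp ρA) v :=
      fun v hv => R.noAt_of_isNearlyOrdinaryAt πA hπA hdef.residual_eq hv (hdef.isNearlyOrdinaryAt v hv)
    obtain ⟨ρr, hρr, e⟩ := R.exists_rigid (π := (πA : A →+* k)) hπA hπoA hc' hr' hu' hn'
    have hmem : ρr ∈ (R.liftingCondition hk).carrier (CNLAlgebra.mk A πA hπA) := hρr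
    obtain ⟨φ, hφ, hφu⟩ := huniv (CNLAlgebra.mk A πA hπA) ρr hmem
    refine ⟨φ, ?_, fun ψ hψ => ?_⟩
    · change IsStrictEquiv (πA : A →+* k) ((Matrix.GeneralLinearGroup.map (φ : Rᵤ →+* A)).comp
        ((MulAut.conj (R.EA Rᵤ)).toMonoidHom.comp ρu)) ρA
      rw [map_comp_conj, R.map_EA φ]
      have hφ' : (Matrix.GeneralLinearGroup.map (φ : Rᵤ →+* A)).comp ρu = ρr := hφ
      rw [hφ']
      have h1 := (e.conj (R.EA A)).symm
      rw [conj_comp_conj, mul_inv_cancel, conj_one_comp] at h1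
      exact h1
    · apply hφu
      change IsStrictEquiv (πA : A →+* k) ((Matrix.GeneralLinearGroup.map (ψ : Rᵤ →+* A)).comp
        ((MulAut.conj (R.EA Rᵤ)).toMonoidHom.comp ρu)) ρA at hψ
      change (Matrix.GeneralLinearGroup.map (ψ : Rᵤ →+* A)).comp ρu = ρr
      have h1 : (Matrix.GeneralLinearGroup.map (ψ : Rᵤ →+* A)).comp ρu ∈
          (R.liftingCondition hk).carrier (CNLAlgebra.mk A πA hπA) :=
        (R.liftingCondition hk).map_mem (A := Rᵤ) (B := CNLAlgebra.mk A πA hπA) ψ hρu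
      have h2 : R.IsRigidLift (πA : A →+* k) ((Matrix.GeneralLinearGroup.map (ψ : Rᵤ →+* A)).comp ρu) := h1
      rw [map_comp_conj, R.map_EA ψ] at hψ
      have h4 := hψ.conj (R.EA A)⁻¹
      rw [conj_comp_conj, inv_mul_cancel, conj_one_comp] at h4
      exact R.rigid_unique (π := (πA : A →+* k)) hπA hπoA h2 hρr (h4.trans e)

end RigidData

/-- **CM's existence of the nearly ordinary deformation ring, reduced to the finiteness of the
`k[ε]`-points of the rigid lifting condition** (Mazur's `Φ_p`-type input). [cite: CalegariMazur2008, §2.2]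
[cite: Mazur1997Deformation, §20 Prop. 2 and §30] -/
theorem nearlyOrdinaryDeformationRing_nonempty_of_finite
    (hfin : ∀ (F : Type) [Field F] [NumberField F] (p : ℕ) [Fact p.Prime] (𝒪 : Type) [CommRing 𝒪]
      [IsLocalRing 𝒪] [IsNoetherianRing 𝒪] [IsAdicComplete (IsLocalRing.maximalIdeal 𝒪) 𝒪]
      (k : Type) [Field k] [Finite k] [CharP k p] [Algebra 𝒪 k] (𝒟 : NearlyOrdinaryDatum F p 𝒪 k)
      (R : 𝒟.RigidData), ((R.liftingCondition 𝒟.residueMap_surjective).carrier (dualCNL 𝒪 k)).Finite) :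
    nearlyOrdinaryDeformationRing_nonempty := by
  intro F _ _ p _ 𝒪 _ _ _ _ k _ _ _ _ 𝒟 _ hsc hdist
  obtain ⟨R⟩ := 𝒟.nonempty_rigidData (Fact.out : p.Prime) hsc hdist
  exact R.nonempty_deformationRing (hfin F p 𝒪 k 𝒟 R)

end NearlyOrdinaryDatum


/-! ### Matrices over the dual numbers -/

namespace Deformation

section DualMatrices

variable {K : Type*} [CommRing K] {n : Type*} [Fintype n] [DecidableEq n]

open TrivSqZeroExt

omit [DecidableEq n] in
/-- `fst` of a product of matrices over `K[ε]`. [folklore] -/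
theorem matrix_map_fst_mul (N N' : Matrix n n (TrivSqZeroExt K K)) :
    (N * N').map fst = N.map fst * N'.map fst := by
  ext i j
  simp only [Matrix.map_apply, Matrix.mul_apply, TrivSqZeroExt.fst_sum, TrivSqZeroExt.fst_mul]

omit [DecidableEq n] in
/-- `snd` of a product of matrices over `K[ε]` (Leibniz rule). [folklore] -/
theorem matrix_map_snd_mul (N N' : Matrix n n (TrivSqZeroExt K K)) :
    (N * N').map snd = N.map fst * N'.map snd + N.map snd * N'.map fst := by
  ext i j
  simp only [Matrix.map_apply, Matrix.mul_apply, Matrix.add_apply, TrivSqZeroExt.snd_sum,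
    TrivSqZeroExt.snd_mul, smul_eq_mul, MulOpposite.smul_eq_mul_unop, MulOpposite.unop_op,
    Finset.sum_add_distrib]

omit [CommRing K] [Fintype n] [DecidableEq n] in
/-- A matrix over `K[ε]` is determined by its `fst` and `snd` parts. [folklore] -/
theorem matrix_ext_fst_snd {N N' : Matrix n n (TrivSqZeroExt K K)} (h₁ : N.map fst = N'.map fst)
    (h₂ : N.map snd = N'.map snd) : N = N' := by
  ext i j : 1
  exact TrivSqZeroExt.ext (congrFun (congrFun h₁ i) j) (congrFun (congrFun h₂ i) j)

omit [Fintype n] in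
/-- `snd` of the identity matrix vanishes. [folklore] -/
theorem matrix_map_snd_one : (1 : Matrix n n (TrivSqZeroExt K K)).map snd = 0 := by
  ext i j
  rw [Matrix.map_apply, Matrix.one_apply, Matrix.zero_apply]
  split_ifs
  · exact TrivSqZeroExt.snd_one
  · exact TrivSqZeroExt.snd_zero

end DualMatrices

section OpenKernel

variable {G H : Type*} [Group G] [TopologicalSpace G] [ContinuousMul G] [Group H]

/-- A homomorphism with open kernel pulls every set back to an open set. [folklore] -/
theorem isOpen_preimage_of_isOpen_ker (ρ : G →* H) (hker : IsOpen (ρ.ker : Set G)) (T : Set H) :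
    IsOpen (ρ ⁻¹' T) := by
  rw [isOpen_iff_forall_mem_open]
  intro γ hγ
  refine ⟨{x | γ⁻¹ * x ∈ ρ.ker}, fun x hx => ?_, hker.preimage (continuous_const.mul continuous_id), by simp⟩
  simp only [Set.mem_setOf_eq, MonoidHom.mem_ker, map_mul, map_inv, inv_mul_eq_one] at hx
  show ρ x ∈ T
  rw [← hx]; exact hγ

/-- `GL_n(f)` is injective for `f` injective. [folklore] -/
theorem generalLinearGroup_map_injective {A B : Type*} [CommRing A] [CommRing B] {n : Type*}
    [Fintype n] [DecidableEq n] (f : A →+* B) (hf : Function.Injective f) :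
    Function.Injective (Matrix.GeneralLinearGroup.map (n := n) f) := by
  intro P Q h
  apply Units.ext; ext i j; apply hf
  rw [← Matrix.GeneralLinearGroup.map_apply, ← Matrix.GeneralLinearGroup.map_apply, h]

end OpenKernel

section Dual

universe u

variable {𝒪 : Type u} [CommRing 𝒪] {k : Type u} [Field k] [Algebra 𝒪 k] [Finite k]

/-- `𝔪_{k[ε]}² = 0`. [folklore] -/
theorem maximalIdeal_dualCNL_sq : maximalIdeal (dualCNL 𝒪 k) ^ 2 = ⊥ := by
  rw [eq_bot_iff, pow_two, Ideal.mul_le]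
  intro r hr s hs
  rw [← CNLAlgebra.ker_residue, RingHom.mem_ker] at hr hs
  change TrivSqZeroExt.fst r = 0 at hr
  change TrivSqZeroExt.fst s = 0 at hs
  rw [Ideal.mem_bot]
  have er := TrivSqZeroExt.inl_fst_add_inr_snd_eq r
  have es := TrivSqZeroExt.inl_fst_add_inr_snd_eq s
  rw [hr, TrivSqZeroExt.inl_zero, zero_add] at er
  rw [hs, TrivSqZeroExt.inl_zero, zero_add] at es
  have h0 : (TrivSqZeroExt.inr (TrivSqZeroExt.snd r) : TrivSqZeroExt k k) *
      TrivSqZeroExt.inr (TrivSqZeroExt.snd s) = 0 := TrivSqZeroExt.inr_mul_inr _ _ _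
  rw [er, es] at h0
  exact h0

/-- `k[ε]` is finite. [folklore] -/
instance finite_dualCNL : Finite (dualCNL 𝒪 k) := inferInstanceAs (Finite (k × k))

variable {n : Type*} [Fintype n] [DecidableEq n]

omit [DecidableEq n] in
/-- `snd` of a product of matrices over the object `k[ε]` (Leibniz rule). [folklore] -/
theorem dualCNL_map_snd_mul (N N' : Matrix n n (dualCNL 𝒪 k)) :
    (N * N').map TrivSqZeroExt.snd = N.map TrivSqZeroExt.fst * N'.map TrivSqZeroExt.snd +
      N.map TrivSqZeroExt.snd * N'.map TrivSqZeroExt.fst :=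
  matrix_map_snd_mul (K := k) N N'

omit [Fintype n] [DecidableEq n] in
/-- A matrix over the object `k[ε]` is determined by its `fst` and `snd` parts. [folklore] -/
theorem dualCNL_matrix_ext {N N' : Matrix n n (dualCNL 𝒪 k)} (h₁ : N.map TrivSqZeroExt.fst = N'.map TrivSqZeroExt.fst)
    (h₂ : N.map TrivSqZeroExt.snd = N'.map TrivSqZeroExt.snd) : N = N' :=
  matrix_ext_fst_snd (K := k) h₁ h₂

omit [Fintype n] in
/-- `snd` of the identity matrix over the object `k[ε]` vanishes. [folklore] -/
theorem dualCNL_map_snd_one : (1 : Matrix n n (dualCNL 𝒪 k)).map TrivSqZeroExt.snd = 0 :=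
  matrix_map_snd_one (K := k)

/-- A continuous representation over `k[ε]` has open kernel. [folklore] -/
theorem isOpen_ker_of_isAdicContinuous_dualCNL {Γ : Type*} [Group Γ] [TopologicalSpace Γ] {n : ℕ}
    {ρ : Γ →* GL (Fin n) (dualCNL 𝒪 k)} (h : IsAdicContinuous ρ) : IsOpen (ρ.ker : Set Γ) := by
  have h2 := h 2
  have hinj : Function.Injective (Ideal.Quotient.mk (maximalIdeal (dualCNL 𝒪 k) ^ 2)) := by
    rw [RingHom.injective_iff_ker_eq_bot, Ideal.mk_ker, maximalIdeal_dualCNL_sq]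
  have hker : ((Matrix.GeneralLinearGroup.map (Ideal.Quotient.mk (maximalIdeal (dualCNL 𝒪 k) ^ 2))).comp ρ).ker =
      ρ.ker := by
    ext γ
    simp only [MonoidHom.mem_ker, MonoidHom.comp_apply]
    constructor
    · intro hγ
      exact generalLinearGroup_map_injective _ hinj (by rw [hγ, map_one])
    · intro hγ; rw [hγ, map_one]
  rwa [hker] at h2

end Dual

end Deformation

/-! ### Finiteness of the rigid lifts to `k[ε]` -/

namespace NearlyOrdinaryDatum

namespace RigidData

open Deformation Literature.NumberTheory.EllipticCurves

variable {F : Type} [Field F] [NumberField F] {p : ℕ} {𝒪 : Type} [CommRing 𝒪] {k : Type}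
  [Field k] [Algebra 𝒪 k] [Finite k] {𝒟 : NearlyOrdinaryDatum F p 𝒪 k} (R : 𝒟.RigidData)
  (hk : Function.Surjective (algebraMap 𝒪 k))

/-- The tangent cocycle `σ ↦ snd ρ(σ)` of a lift to `k[ε]`, restricted to a subgroup. [folklore] -/
def tangentMap (ρ : absoluteGaloisGroup F →* GL (Fin 2) (dualCNL 𝒪 k)) (U : Subgroup (absoluteGaloisGroup F)) :
    U → Matrix (Fin 2) (Fin 2) k :=
  fun σ => (ρ σ).val.map TrivSqZeroExt.snd

/-- On `ker r̄'`, an admissible lift to `k[ε]` has `fst`-part `1`. [folklore] -/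
theorem map_fst_eq_one {ρ : absoluteGaloisGroup F →* GL (Fin 2) (dualCNL 𝒪 k)}
    (hρ : ρ ∈ (R.liftingCondition hk).carrier (dualCNL 𝒪 k)) {σ : absoluteGaloisGroup F}
    (hσ : σ ∈ (𝒟.conjResidual R.E).ker) : (ρ σ).val.map TrivSqZeroExt.fst = 1 := by
  ext i j
  have h := (R.liftingCondition hk).residue_apply_val hρ σ i j
  rw [MonoidHom.mem_ker] at hσ
  rw [hσ] at h
  exact h

/-- **The tangent map of a rigid lift to `k[ε]` lies in `Hom(ker r̄', M₂(k); S)`**: it is continuous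
(the lift has open kernel), additive on `ker r̄'` (Leibniz rule with `fst = 1`), and vanishes on the
inertia groups above `v ∉ S` (the lift is unramified there). [cite: Mazur1997Deformation, §21] -/
theorem tangentMap_mem_unramifiedHoms [TopologicalSpace (Matrix (Fin 2) (Fin 2) k)]
    [DiscreteTopology (Matrix (Fin 2) (Fin 2) k)]
    {ρ : absoluteGaloisGroup F →* GL (Fin 2) (dualCNL 𝒪 k)}
    (hρ : ρ ∈ (R.liftingCondition hk).carrier (dualCNL 𝒪 k)) :
    tangentMap ρ (𝒟.conjResidual R.E).ker ∈
      unramifiedHoms (𝒟.conjResidual R.E).ker (Matrix (Fin 2) (Fin 2) k) 𝒟.S := by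
  have hρ' : R.IsRigidLift ((dualCNL 𝒪 k).residue : dualCNL 𝒪 k →+* k) ρ := hρ
  refine ⟨?_, fun σ τ => ?_, fun v hv 𝔓 h𝔓 σ hσ => ?_⟩
  · have hker := isOpen_ker_of_isAdicContinuous_dualCNL hρ'.isAdicContinuous
    have hc : Continuous fun γ : absoluteGaloisGroup F => (ρ γ).val.map TrivSqZeroExt.snd :=
      continuous_def.2 fun T _ => isOpen_preimage_of_isOpen_ker ρ hker
        ((fun P : GL (Fin 2) (dualCNL 𝒪 k) => P.val.map TrivSqZeroExt.snd) ⁻¹' T)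
    exact hc.comp continuous_subtype_val
  · change (ρ (σ.1 * τ.1)).val.map TrivSqZeroExt.snd =
      (ρ σ.1).val.map TrivSqZeroExt.snd + (ρ τ.1).val.map TrivSqZeroExt.snd
    rw [map_mul, Units.val_mul, dualCNL_map_snd_mul, R.map_fst_eq_one hk hρ σ.2, R.map_fst_eq_one hk hρ τ.2,
      Matrix.one_mul, Matrix.mul_one, add_comm]
  · change (ρ σ.1).val.map TrivSqZeroExt.snd = 0
    rw [hρ'.unramified v hv 𝔓 h𝔓 σ.1 hσ, Units.val_one, dualCNL_map_snd_one]

/-- **Finiteness of the `k[ε]`-points of the rigid lifting condition** (Mazur's hypothesis `Φ_p`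
for `Π = G_{F,S}` in the form needed by §20 Prop. 2): a rigid lift `ρ` of `r̄' = Ē⁻¹ ρ̄ Ē` to `k[ε]`
is determined by its values on coset representatives of the open subgroup `ker r̄'` and by its
tangent map on `ker r̄'`, which lies in the finite set `Hom(ker r̄', M₂(k); S)` (Silverman
Prop. VIII.1.6 / Hermite–Minkowski, `finite_unramifiedHoms_holds`).
[cite: Mazur1997Deformation, §21] [cite: SilvermanAEC2009, Prop. VIII.1.6] -/
theorem finite_carrier_dualCNL : ((R.liftingCondition hk).carrier (dualCNL 𝒪 k)).Finite := by
  classical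
  letI : TopologicalSpace (Matrix (Fin 2) (Fin 2) k) := ⊥
  haveI : DiscreteTopology (Matrix (Fin 2) (Fin 2) k) := ⟨rfl⟩
  set U := (𝒟.conjResidual R.E).ker with hU
  have hUo : IsOpen (U : Set (absoluteGaloisGroup F)) := by
    rw [hU, ker_conjResidual]; exact 𝒟.isOpen_ker_residual
  haveI : Finite (absoluteGaloisGroup F ⧸ U) := Subgroup.quotient_finite_of_isOpen U hUo
  haveI : Finite (GL (Fin 2) (dualCNL 𝒪 k)) := Finite.of_injective _ Units.val_injective
  have hfinHom : (unramifiedHoms U (Matrix (Fin 2) (Fin 2) k) 𝒟.S).Finite :=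
    finite_unramifiedHoms_holds F U hUo (Matrix (Fin 2) (Fin 2) k) 𝒟.S_finite
  let Φ : (absoluteGaloisGroup F →* GL (Fin 2) (dualCNL 𝒪 k)) →
      (U → Matrix (Fin 2) (Fin 2) k) × (absoluteGaloisGroup F ⧸ U → GL (Fin 2) (dualCNL 𝒪 k)) :=
    fun ρ => (tangentMap ρ U, fun q => ρ q.out)
  refine Set.Finite.of_finite_image (f := Φ) ((hfinHom.prod (Set.finite_univ)).subset ?_) ?_
  · rintro _ ⟨ρ, hρ, rfl⟩
    exact ⟨R.tangentMap_mem_unramifiedHoms hk hρ, Set.mem_univ _⟩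
  · intro ρ₁ h₁ ρ₂ h₂ h
    have hf : tangentMap ρ₁ U = tangentMap ρ₂ U := congrArg Prod.fst h
    have hq : ∀ q : absoluteGaloisGroup F ⧸ U, ρ₁ q.out = ρ₂ q.out := fun q => congrFun (congrArg Prod.snd h) q
    have hUeq : ∀ u : absoluteGaloisGroup F, u ∈ U → ρ₁ u = ρ₂ u := by
      intro u hu
      apply Units.ext
      refine dualCNL_matrix_ext ?_ ?_
      · rw [R.map_fst_eq_one hk h₁ hu, R.map_fst_eq_one hk h₂ hu]
      · exact congrFun hf ⟨u, hu⟩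
    ext γ : 1
    obtain ⟨u, hu⟩ := QuotientGroup.mk_out_eq_mul U γ
    have hγ : γ = (QuotientGroup.mk γ : absoluteGaloisGroup F ⧸ U).out * (u : absoluteGaloisGroup F)⁻¹ := by
      rw [hu, mul_inv_cancel_right]
    rw [hγ, map_mul, map_mul, map_inv, map_inv, hq, hUeq u u.2]

end RigidData

end NearlyOrdinaryDatum

/-- **Calegari–Mazur: existence of the universal nearly ordinary deformation ring** (discharge of
`nearlyOrdinaryDeformationRing_nonempty`).  *"Suppose `ρ̄` satisfies `End_𝔽(ρ̄) = 𝔽` and is nearly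
ordinary and distinguished for each `v ∣ p`.  Then `ρ̄` admits a universal nearly ordinary
deformation ring `R(ρ̄)`"* — "the proof of this is standard, see [Mazur, §30]".  Proof as in Mazur:
the nearly ordinary deformations form (after Skinner–Wiles rigidification,
`NearlyOrdinaryDatum.RigidData.liftingCondition`) a deformation condition for `Π = Γ_F`, whose
`k[ε]`-points are finite by the `p`-finiteness of `G_{F,S}` (`finite_carrier_dualCNL`, from
Silverman VIII.1.6), so Mazur's §20 Prop. 2 (`LiftingCondition.exists_universal_of_finite`, made
explicit as a sequential limit of the finite-level universal rings) represents it; the universal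
rigid lift conjugated back by `E` is the universal nearly ordinary deformation
(`RigidData.nonempty_deformationRing`). [cite: CalegariMazur2008, §2.2 (arXiv 0708.2451, p. 9)]
[cite: Mazur1997Deformation, §20 Prop. 2, §23, §30] -/
theorem nearlyOrdinaryDeformationRing_nonempty_holds : nearlyOrdinaryDeformationRing_nonempty :=
  NearlyOrdinaryDatum.nearlyOrdinaryDeformationRing_nonempty_of_finite
    fun _ _ _ _ _ _ _ _ _ _ _ _ _ _ _ 𝒟 R => R.finite_carrier_dualCNL 𝒟.residueMap_surjective

end Literature.NumberTheory.GaloisRepresentations
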